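import Summits.QuantumFields.YangMills.Theorems.SwapVirialDeficitBlowUpVirialZLetterShare
import HarnessLib

/-!
# The HUB-SOFT letters `x, y`: their share of `½⟪W⟫` is controlled by the mean deficit PLUS the Gibbs mass of the BAD HUBS — unconditionally, every `L`, `b`, `θ`
# (free-hands support of ⟨stmt-QuantumFields-24197⟩ `SwapVirialDeficit.SwapGluedStiffness`; the quantitative ring-level form of the "k = 2" valley count)

After ✓`followersW_term_apriori` (followers) and ✓`zW_term_apriori` (the `z` letter) the weight part of the residue (LW) of ⟨24197⟩ is the two HUB-SOFT leader letters
`W_x + W_y = gnoWtr(η_x) + gnoWtr(η_y)` whose stiffness degenerates with the hub angle `ψ`: w2 g57's pointwise ✓`leadersW_hubStiff_le`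
`sin²2ψ·W_x + sin²ψ·W_y + W_z ≤ 16200·L⁶·F̂` (`sin ψ = ‖Im a‖/‖a‖`, `cos ψ = re a/‖a‖`).  Splitting the hub integral at a stiffness threshold `θ ∈ (0, 1]`:
* §1 the GOOD HUBS `{a | θ ≤ sin²2ψ ∧ θ ≤ sin²ψ}` (measurable; `0 ∉`), `softW_le_of_goodHub` (`W_x + W_y ≤ (16200L⁶/θ)·F̂` there), `softW_nonneg_le` (`≤ 8`), integrability;
* §2 ★★★ `softW_term_le (hθ : 0 < θ) (hb : 0 < b)` — for EVERY `L`: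
  `½·K_L·⟪W_x + W_y⟫_{000,b} ≤ (8100·L⁶/θ)·E₀(b) + 4·K_L·∫_{bad hubs} (Σ_ε ∫ e^{−bF̂₀}ρ) ∂cone`,
  i.e. (mean deficit, FREE by ✓`swap_meanDeficit_apriori`: `O(L^{10} log b/(θ b))·Z₀`) + (the GIBBS MASS OF THE BAD HUBS `ψ² ≲ θ` or `cos²ψ ≲ θ`);
  ★★ `softW_term_apriori` — the same with `E₀` replaced by its window-uniform a-priori ceiling.
So the weight part of (LW) reduces to (HM): a SMALL-BALL BOUND FOR ONE MARGINAL (the hub angle) of the σ-ring Gibbs state, `K_L·∫_{bad_θ} Σ_ε∫e^{−bF̂₀}ρ ≤ δ·Z₀(b)`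
with `θ = θ(b) → 0` slowly (e.g. `θ = b^{−1/2}`; expected `δ ≍ θ^{1/2}·poly(L)` from the valley count) — OPEN, uniform in `L`.
HONEST LABEL: an unconditional inequality; (HM), (LW), (M), ⟨24197⟩ ∕ ⟨24194⟩ ∕ ⟨24196⟩ ∕ ⟨24497⟩ OPEN; the Yang–Mills mass gap is NOT proved; no summit is proved by a line.
Seat ym-line-fcl-p3 g46 (cell ym-idea-1, free hands; item of record ⟨24085⟩ aside, untouched), `--supports stmt-QuantumFields-24197`.  THEOREMS ONLY, 0 `sorry`,
standard axioms; the series' local `ℍ` instances.  References: [cite: Luscher1983, §2]; [cite: Griffiths1964]; [folklore].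
-/

set_option autoImplicit false
set_option synthInstance.maxSize 1024

noncomputable section

open MeasureTheory Quaternion Set Filter Topology
open scoped Quaternion BigOperators
open Literature.MathematicalPhysics.QuantumLattice
open Literature.MathematicalPhysics.QuantumFieldTheory hiding SU2
open Summit.QuantumFields.YangMills.Theorems.FemtoTransferGap
open Summit.QuantumFields.YangMills.Theorems.FemtoTransferGap.TT
open Summit.QuantumFields.YangMills.Theorems.VirialFluxGap.RingDeficit
open Summit.QuantumFields.YangMills.Theorems.SwapTwistDeficit.ToronLog (coneMeasure coneConst coneConst_pos isProbabilityMeasure_coneMeasure)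
open Summit.QuantumFields.YangMills.Theorems.SwapVirialDeficit.SwapRing
open Summit.QuantumFields.YangMills.Theorems.SwapVirialDeficit.Gnomonic (gnomonicW gnomonicW_nonneg_le)
open Summit.QuantumFields.YangMills.Theorems.SwapVirialDeficit.ZeroModeSigma (ae_ne_zero_coneMeasure)

attribute [local instance] Literature.Analysis.FluidPDE.Tao2016.quatMeasurableSpace
  Literature.Analysis.FluidPDE.Tao2016.quatBorelSpace
  Literature.MathematicalPhysics.QuantumLattice.secondCountableTopology_su2

namespace Summit.QuantumFields.YangMills.Theorems.SwapVirialDeficit.BlowUpRing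

variable {L : ℕ} [NeZero L]

/-! ## §1 Good hubs and the soft weight -/

omit [NeZero L] in
/-- The set of GOOD HUBS at stiffness threshold `θ` is measurable. [folklore] -/
theorem measurableSet_goodHub (θ : ℝ) :
    MeasurableSet {a : ℍ | θ ≤ (2 * (‖a‖⁻¹ * a.re) * (‖a‖⁻¹ * ‖a.im‖)) ^ 2 ∧ θ ≤ (‖a‖⁻¹ * ‖a.im‖) ^ 2} := by
  have h1 : Measurable fun a : ℍ => ‖a‖⁻¹ := measurable_norm.inv
  have h2 : Measurable fun a : ℍ => a.re := Quaternion.continuous_re.measurable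
  have h3 : Measurable fun a : ℍ => ‖a.im‖ := Quaternion.continuous_im.measurable.norm
  have hsx : Measurable fun a : ℍ => (2 * (‖a‖⁻¹ * a.re) * (‖a‖⁻¹ * ‖a.im‖)) ^ 2 :=
    (((measurable_const.mul (h1.mul h2)).mul (h1.mul h3))).pow_const 2
  have hsy : Measurable fun a : ℍ => (‖a‖⁻¹ * ‖a.im‖) ^ 2 := (h1.mul h3).pow_const 2
  have hθ : Measurable fun _ : ℍ => θ := measurable_const
  exact (measurableSet_le hθ hsx).inter (measurableSet_le hθ hsy)

omit [NeZero L] in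
/-- A good hub is non-zero (`θ > 0`). [folklore] -/
theorem ne_zero_of_goodHub {θ : ℝ} (hθ : 0 < θ) {a : ℍ}
    (ha : a ∈ {a : ℍ | θ ≤ (2 * (‖a‖⁻¹ * a.re) * (‖a‖⁻¹ * ‖a.im‖)) ^ 2 ∧ θ ≤ (‖a‖⁻¹ * ‖a.im‖) ^ 2}) : a ≠ 0 := by
  rintro rfl
  have h := ha.2
  simp at h
  linarith

omit [NeZero L] in
/-- `0 ≤ W_x + W_y ≤ 8`. [folklore] -/
theorem softW_nonneg_le (η : GnoCoord L) : 0 ≤ gnoWtr η.1.1 + gnoWtr η.1.2 ∧ gnoWtr η.1.1 + gnoWtr η.1.2 ≤ 8 := by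
  obtain ⟨a1, a2⟩ := gnoWtr_nonneg_le η.1.1
  obtain ⟨b1, b2⟩ := gnoWtr_nonneg_le η.1.2
  constructor <;> linarith

/-- ★ **On a good hub the soft weight is dominated by the deficit**: `W_x + W_y ≤ (16200L⁶/θ)·F̂` (✓`leadersW_hubStiff_le`). [cite: Luscher1983, §2] -/
theorem softW_le_of_goodHub {θ : ℝ} (hθ : 0 < θ) {a : ℍ}
    (ha : a ∈ {a : ℍ | θ ≤ (2 * (‖a‖⁻¹ * a.re) * (‖a‖⁻¹ * ‖a.im‖)) ^ 2 ∧ θ ≤ (‖a‖⁻¹ * ‖a.im‖) ^ 2}) (ε : GnoSign L) (η : GnoCoord L) :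
    gnoWtr η.1.1 + gnoWtr η.1.2 ≤ 16200 * (L : ℝ) ^ 6 / θ * gnoDeficit (fun _ => false) (fun _ => 1) a ε η := by
  have h := leadersW_hubStiff_le (L := L) (ne_zero_of_goodHub hθ ha) ε η
  obtain ⟨hx, hy⟩ := ha
  have wx := (gnoWtr_nonneg_le η.1.1).1
  have wy := (gnoWtr_nonneg_le η.1.2).1
  have wz := (gnomonicW_nonneg_le η.2.1).1
  have hF : gnoDeficit (fun _ => false) (fun _ => (1 : SU2)) a ε η = chartDeficit L (fun _ => false) (fun _ => 1) (blowUpPoint 1 (gnomonicPoint a ε η)) := rfl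
  rw [hF, div_mul_eq_mul_div, le_div_iff₀ hθ]
  have e1 : θ * gnoWtr η.1.1 ≤ (2 * (‖a‖⁻¹ * a.re) * (‖a‖⁻¹ * ‖a.im‖)) ^ 2 * gnoWtr η.1.1 := mul_le_mul_of_nonneg_right hx wx
  have e2 : θ * gnoWtr η.1.2 ≤ (‖a‖⁻¹ * ‖a.im‖) ^ 2 * gnoWtr η.1.2 := mul_le_mul_of_nonneg_right hy wy
  nlinarith

omit [NeZero L] in
/-- `W_x + W_y` is measurable on `GnoCoord L`. [folklore] -/
theorem measurable_softW : Measurable fun η : GnoCoord L => gnoWtr η.1.1 + gnoWtr η.1.2 :=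
  (continuous_gnoWtr.measurable.comp (measurable_fst.comp measurable_fst)).add (continuous_gnoWtr.measurable.comp (measurable_snd.comp measurable_fst))

/-- The soft weight fibre integrand is integrable. [folklore] -/
theorem integrable_softW_fibre (z : Fin 3 → Bool) (a : ℍ) (ε : GnoSign L) {b : ℝ} (hb : 0 ≤ b) :
    Integrable fun η : GnoCoord L => (gnoWtr η.1.1 + gnoWtr η.1.2) * Real.exp (-(b * gnoDeficit z (fun _ => 1) a ε η)) * gnoDensity η := by
  refine (integrable_gnoDensity.const_mul 8).mono'
    ((measurable_softW.mul (((measurable_gnoDeficit z _ a ε).const_mul b).neg.exp)).mul measurable_gnoDensity).aestronglyMeasurable (ae_of_all _ fun η => ?_)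
  obtain ⟨h0, h8⟩ := softW_nonneg_le η
  rw [Real.norm_eq_abs, abs_mul, abs_mul, abs_of_nonneg h0, abs_of_pos (gnoDensity_pos η)]
  have h1 := abs_exp_gnoDeficit_le_one z (fun _ => (1 : SU2)) a ε hb η
  calc (gnoWtr η.1.1 + gnoWtr η.1.2) * |Real.exp (-(b * gnoDeficit z (fun _ => 1) a ε η))| * gnoDensity η ≤ 8 * 1 * gnoDensity η :=
        mul_le_mul_of_nonneg_right (mul_le_mul h8 h1 (abs_nonneg _) (by norm_num)) (gnoDensity_pos η).le
    _ = 8 * gnoDensity η := by rw [mul_one]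

/-- The soft weight functional `a ↦ Σ_ε ∫ (W_x+W_y) e^{−bF̂}ρ` is cone-integrable. [folklore] -/
theorem integrable_fibre_softW (z : Fin 3 → Bool) {b : ℝ} (hb : 0 ≤ b) :
    Integrable (fun a : ℍ => ∑ ε : GnoSign L, ∫ η : GnoCoord L,
      (gnoWtr η.1.1 + gnoWtr η.1.2) * Real.exp (-(b * gnoDeficit z (fun _ => 1) a ε η)) * gnoDensity η) coneMeasure :=
  integrable_sum_fibre z (fun _ => 1) (g := fun _ p => gnoWtr p.2.1.1 + gnoWtr p.2.1.2) (fun _ => (measurable_softW.comp measurable_snd).aemeasurable) (M := 8)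
    (fun _ p => by obtain ⟨h0, h1⟩ := softW_nonneg_le p.2; rw [abs_of_nonneg h0]; exact h1) hb

/-- Fibrewise on a good hub: `∫ (W_x+W_y) e^{−bF̂₀}ρ ≤ (16200L⁶/θ)·∫ F̂₀ e^{−bF̂₀}ρ`. [folklore] -/
theorem softW_fibre_le_of_goodHub {θ : ℝ} (hθ : 0 < θ) {a : ℍ}
    (ha : a ∈ {a : ℍ | θ ≤ (2 * (‖a‖⁻¹ * a.re) * (‖a‖⁻¹ * ‖a.im‖)) ^ 2 ∧ θ ≤ (‖a‖⁻¹ * ‖a.im‖) ^ 2}) (ε : GnoSign L) {b : ℝ} (hb : 0 < b) :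
    ∫ η : GnoCoord L, (gnoWtr η.1.1 + gnoWtr η.1.2) * Real.exp (-(b * gnoDeficit (fun _ => false) (fun _ => 1) a ε η)) * gnoDensity η ≤
      16200 * (L : ℝ) ^ 6 / θ *
        ∫ η : GnoCoord L, gnoDeficit (fun _ => false) (fun _ => 1) a ε η * Real.exp (-(b * gnoDeficit (fun _ => false) (fun _ => 1) a ε η)) *
          gnoDensity η := by
  rw [← integral_const_mul]
  refine integral_mono (integrable_softW_fibre _ a ε hb.le) ((integrable_gnoDeficit_fibre a ε _ hb).const_mul _) fun η => ?_
  have h := softW_le_of_goodHub (L := L) hθ ha ε η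
  have hE := (Real.exp_pos (-(b * gnoDeficit (fun _ => false) (fun _ => (1 : SU2)) a ε η))).le
  have hρ := (gnoDensity_pos η).le
  show (gnoWtr η.1.1 + gnoWtr η.1.2) * Real.exp (-(b * gnoDeficit (fun _ => false) (fun _ => 1) a ε η)) * gnoDensity η ≤
    16200 * (L : ℝ) ^ 6 / θ * (gnoDeficit (fun _ => false) (fun _ => 1) a ε η * Real.exp (-(b * gnoDeficit (fun _ => false) (fun _ => 1) a ε η)) *
      gnoDensity η)
  rw [show 16200 * (L : ℝ) ^ 6 / θ * (gnoDeficit (fun _ => false) (fun _ => 1) a ε η * Real.exp (-(b * gnoDeficit (fun _ => false) (fun _ => 1) a ε η)) *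
      gnoDensity η) = (16200 * (L : ℝ) ^ 6 / θ * gnoDeficit (fun _ => false) (fun _ => 1) a ε η) *
        Real.exp (-(b * gnoDeficit (fun _ => false) (fun _ => 1) a ε η)) * gnoDensity η by ring]
  exact mul_le_mul_of_nonneg_right (mul_le_mul_of_nonneg_right h hE) hρ

/-- Fibrewise everywhere: `∫ (W_x+W_y) e^{−bF̂}ρ ≤ 8·∫ e^{−bF̂}ρ`. [folklore] -/
theorem softW_fibre_le_eight (z : Fin 3 → Bool) (a : ℍ) (ε : GnoSign L) {b : ℝ} (hb : 0 ≤ b) :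
    ∫ η : GnoCoord L, (gnoWtr η.1.1 + gnoWtr η.1.2) * Real.exp (-(b * gnoDeficit z (fun _ => 1) a ε η)) * gnoDensity η ≤
      8 * ∫ η : GnoCoord L, Real.exp (-(b * gnoDeficit z (fun _ => 1) a ε η)) * gnoDensity η := by
  rw [← integral_const_mul]
  refine integral_mono (integrable_softW_fibre z a ε hb) ((integrable_exp_gnoDeficit_mul z _ ε a hb).const_mul 8) fun η => ?_
  obtain ⟨-, h8⟩ := softW_nonneg_le η
  have hE := (Real.exp_pos (-(b * gnoDeficit z (fun _ => (1 : SU2)) a ε η))).le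
  have hρ := (gnoDensity_pos η).le
  show (gnoWtr η.1.1 + gnoWtr η.1.2) * Real.exp (-(b * gnoDeficit z (fun _ => 1) a ε η)) * gnoDensity η ≤
    8 * (Real.exp (-(b * gnoDeficit z (fun _ => 1) a ε η)) * gnoDensity η)
  rw [← mul_assoc]
  exact mul_le_mul_of_nonneg_right (mul_le_mul_of_nonneg_right h8 hE) hρ

/-! ## §2 The soft weight term: mean deficit plus bad-hub mass -/

/-- ★★★ **THE HUB-SOFT LETTERS' SHARE OF `½⟪W⟫`, SPLIT AT A STIFFNESS THRESHOLD `θ`**: for every `L`, every `b > 0` and every `θ > 0`,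
`½·K_L·∫_cone Σ_ε ∫ (W_x + W_y) e^{−bF̂₀}ρ ≤ (8100·L⁶/θ)·∫ F^S_0 e^{−bF^S_0} dμ_L + 4·K_L·∫_{bad hubs} Σ_ε ∫ e^{−bF̂₀}ρ ∂cone`
(good hubs: ✓`leadersW_hubStiff_le` + ✓`integral_swapDeficit_exp_eq_gnomonic`; bad hubs: `W_x + W_y ≤ 8`). [cite: Luscher1983, §2] -/
theorem softW_term_le {θ : ℝ} (hθ : 0 < θ) {b : ℝ} (hb : 0 < b) :
    1 / 2 * ((coneConst ^ 3 / 64 * (1 / (2 * Real.pi ^ 2)) ^ Fintype.card (Fol L)) *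
        ∫ a, (∑ ε : GnoSign L, ∫ η : GnoCoord L,
          (gnoWtr η.1.1 + gnoWtr η.1.2) * Real.exp (-(b * gnoDeficit (fun _ => false) (fun _ => 1) a ε η)) * gnoDensity η) ∂coneMeasure) ≤
      8100 * (L : ℝ) ^ 6 / θ * ∫ p, swapRingDeficit L (fun _ => false) p * Real.exp (-(b * swapRingDeficit L (fun _ => false) p)) ∂(ringMeasure L)
        + 4 * ((coneConst ^ 3 / 64 * (1 / (2 * Real.pi ^ 2)) ^ Fintype.card (Fol L)) *
          ∫ a in {a : ℍ | θ ≤ (2 * (‖a‖⁻¹ * a.re) * (‖a‖⁻¹ * ‖a.im‖)) ^ 2 ∧ θ ≤ (‖a‖⁻¹ * ‖a.im‖) ^ 2}ᶜ,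
            (∑ ε : GnoSign L, ∫ η : GnoCoord L, Real.exp (-(b * gnoDeficit (fun _ => false) (fun _ => 1) a ε η)) * gnoDensity η) ∂coneMeasure) := by
  set G : Set ℍ := {a : ℍ | θ ≤ (2 * (‖a‖⁻¹ * a.re) * (‖a‖⁻¹ * ‖a.im‖)) ^ 2 ∧ θ ≤ (‖a‖⁻¹ * ‖a.im‖) ^ 2} with hGdef
  have hG : MeasurableSet G := measurableSet_goodHub θ
  set K : ℝ := coneConst ^ 3 / 64 * (1 / (2 * Real.pi ^ 2)) ^ Fintype.card (Fol L) with hK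
  have hK0 : 0 ≤ K := by rw [hK]; have := coneConst_pos; positivity
  set Φ : ℍ → ℝ := fun a => ∑ ε : GnoSign L, ∫ η : GnoCoord L,
    (gnoWtr η.1.1 + gnoWtr η.1.2) * Real.exp (-(b * gnoDeficit (fun _ => false) (fun _ => 1) a ε η)) * gnoDensity η with hΦ
  set Ψ : ℍ → ℝ := fun a => ∑ ε : GnoSign L, ∫ η : GnoCoord L,
    gnoDeficit (fun _ => false) (fun _ => 1) a ε η * Real.exp (-(b * gnoDeficit (fun _ => false) (fun _ => 1) a ε η)) * gnoDensity η with hΨ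
  set M : ℍ → ℝ := fun a => ∑ ε : GnoSign L, ∫ η : GnoCoord L,
    Real.exp (-(b * gnoDeficit (fun _ => false) (fun _ => 1) a ε η)) * gnoDensity η with hM
  have iΦ : Integrable Φ coneMeasure := integrable_fibre_softW (fun _ => false) hb.le
  have iΨ : Integrable Ψ coneMeasure := integrable_fibre_gnoDeficit (fun _ => false) (fun _ => 1) hb
  have iM : Integrable M coneMeasure := integrable_fibre_mass (fun _ => false) (fun _ => 1) hb.le
  have hΨ0 : ∀ a, 0 ≤ Ψ a := fun a => Finset.sum_nonneg fun ε _ => integral_nonneg fun η =>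
    mul_nonneg (mul_nonneg (gnoDeficit_nonneg _ _ a ε η) (Real.exp_pos _).le) (gnoDensity_pos η).le
  -- split the hub integral
  have hsplit : ∫ a, Φ a ∂coneMeasure = (∫ a in G, Φ a ∂coneMeasure) + ∫ a in Gᶜ, Φ a ∂coneMeasure := (integral_add_compl hG iΦ).symm
  -- good hubs
  have hgood : ∫ a in G, Φ a ∂coneMeasure ≤ 16200 * (L : ℝ) ^ 6 / θ * ∫ a, Ψ a ∂coneMeasure := by
    have h1 : ∫ a in G, Φ a ∂coneMeasure ≤ ∫ a in G, 16200 * (L : ℝ) ^ 6 / θ * Ψ a ∂coneMeasure := by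
      refine setIntegral_mono_on iΦ.integrableOn (iΨ.const_mul _).integrableOn hG fun a ha => ?_
      show Φ a ≤ 16200 * (L : ℝ) ^ 6 / θ * Ψ a
      rw [hΦ, hΨ]
      dsimp only
      rw [Finset.mul_sum]
      exact Finset.sum_le_sum fun ε _ => softW_fibre_le_of_goodHub hθ ha ε hb
    rw [integral_const_mul] at h1
    have h2 : ∫ a in G, Ψ a ∂coneMeasure ≤ ∫ a, Ψ a ∂coneMeasure := setIntegral_le_integral iΨ (ae_of_all _ fun a => hΨ0 a)
    exact h1.trans (mul_le_mul_of_nonneg_left h2 (by positivity))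
  -- bad hubs
  have hbad : ∫ a in Gᶜ, Φ a ∂coneMeasure ≤ 8 * ∫ a in Gᶜ, M a ∂coneMeasure := by
    rw [← integral_const_mul]
    refine setIntegral_mono_on iΦ.integrableOn (iM.const_mul _).integrableOn hG.compl fun a _ => ?_
    show Φ a ≤ 8 * M a
    rw [hΦ, hM]
    dsimp only
    rw [Finset.mul_sum]
    exact Finset.sum_le_sum fun ε _ => softW_fibre_le_eight (fun _ => false) a ε hb.le
  -- the mean deficit in the chart
  have hE : ∫ p, swapRingDeficit L (fun _ => false) p * Real.exp (-(b * swapRingDeficit L (fun _ => false) p)) ∂(ringMeasure L) = K * ∫ a, Ψ a ∂coneMeasure :=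
    integral_swapDeficit_exp_eq_gnomonic (fun _ => false) hb.le
  rw [hE, hsplit]
  show 1 / 2 * (K * ((∫ a in G, Φ a ∂coneMeasure) + ∫ a in Gᶜ, Φ a ∂coneMeasure)) ≤
    8100 * (L : ℝ) ^ 6 / θ * (K * ∫ a, Ψ a ∂coneMeasure) + 4 * (K * ∫ a in Gᶜ, M a ∂coneMeasure)
  have hsum := mul_le_mul_of_nonneg_left (mul_le_mul_of_nonneg_left (add_le_add hgood hbad) hK0) (by norm_num : (0 : ℝ) ≤ 1 / 2)
  calc 1 / 2 * (K * ((∫ a in G, Φ a ∂coneMeasure) + ∫ a in Gᶜ, Φ a ∂coneMeasure))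
      ≤ 1 / 2 * (K * (16200 * (L : ℝ) ^ 6 / θ * (∫ a, Ψ a ∂coneMeasure) + 8 * ∫ a in Gᶜ, M a ∂coneMeasure)) := hsum
    _ = 8100 * (L : ℝ) ^ 6 / θ * (K * ∫ a, Ψ a ∂coneMeasure) + 4 * (K * ∫ a in Gᶜ, M a ∂coneMeasure) := by ring

/-- ★★ **The same with the mean deficit replaced by its window-uniform a-priori ceiling** (✓`SwapRing.swap_meanDeficit_apriori`): there are ABSOLUTE `K ≥ 0`, `β₀ ≥ 1`
with, for every `L`, every `b ≥ β₀` and every `θ > 0`,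
`½K_L⟪W_x + W_y⟫₀ ≤ (8100L⁶/θ)·(2(9L⁴−1)log b + K·L⁴(1+log L))/b·Z₀(b) + 4·K_L·∫_{bad hubs} Σ_ε∫e^{−bF̂₀}ρ ∂cone`. [cite: Luscher1983, §2] [cite: Griffiths1964] -/
theorem softW_term_apriori :
    ∃ K : ℝ, 0 ≤ K ∧ ∃ β₀ : ℝ, 1 ≤ β₀ ∧ ∀ (L : ℕ) [NeZero L] (b : ℝ), β₀ ≤ b → ∀ θ : ℝ, 0 < θ →
      1 / 2 * ((coneConst ^ 3 / 64 * (1 / (2 * Real.pi ^ 2)) ^ Fintype.card (Fol L)) *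
          ∫ a, (∑ ε : GnoSign L, ∫ η : GnoCoord L,
            (gnoWtr η.1.1 + gnoWtr η.1.2) * Real.exp (-(b * gnoDeficit (fun _ => false) (fun _ => 1) a ε η)) * gnoDensity η) ∂coneMeasure) ≤
        8100 * (L : ℝ) ^ 6 / θ * ((2 * (9 * (L : ℝ) ^ 4 - 1) * Real.log b + K * (L : ℝ) ^ 4 * (1 + Real.log L)) / b) *
            ∫ p, Real.exp (-(b * swapRingDeficit L (fun _ => false) p)) ∂(ringMeasure L)
          + 4 * ((coneConst ^ 3 / 64 * (1 / (2 * Real.pi ^ 2)) ^ Fintype.card (Fol L)) *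
            ∫ a in {a : ℍ | θ ≤ (2 * (‖a‖⁻¹ * a.re) * (‖a‖⁻¹ * ‖a.im‖)) ^ 2 ∧ θ ≤ (‖a‖⁻¹ * ‖a.im‖) ^ 2}ᶜ,
              (∑ ε : GnoSign L, ∫ η : GnoCoord L, Real.exp (-(b * gnoDeficit (fun _ => false) (fun _ => 1) a ε η)) * gnoDensity η) ∂coneMeasure) := by
  obtain ⟨K, hK, β₀, hβ₀, h⟩ := swap_meanDeficit_apriori
  refine ⟨K, hK, β₀, hβ₀, fun L _ b hb θ hθ => ?_⟩
  haveI := isProbabilityMeasure_ringMeasure (L := L)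
  have hb0 : 0 < b := by linarith
  have h1 := softW_term_le (L := L) hθ hb0
  have h2 := h L b hb
  have hZ : 0 < ∫ p, Real.exp (-(b * swapRingDeficit L (fun _ => false) p)) ∂(ringMeasure L) :=
    integral_exp_pos (integrable_exp_swapDeficit (L := L) (fun _ => false) b)
  have e1 : (fun p => Real.exp (-b * swapRingDeficit L (fun _ => false) p)) = fun p => Real.exp (-(b * swapRingDeficit L (fun _ => false) p)) := by
    funext p; rw [neg_mul]
  have e2 : (fun p => swapRingDeficit L (fun _ => false) p * Real.exp (-b * swapRingDeficit L (fun _ => false) p)) =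
      fun p => swapRingDeficit L (fun _ => false) p * Real.exp (-(b * swapRingDeficit L (fun _ => false) p)) := by
    funext p; rw [neg_mul]
  rw [e1, e2] at h2
  have hx := (le_div_iff₀' hb0).2 h2
  have h3 := (div_le_iff₀ hZ).1 hx
  have hL : (0 : ℝ) ≤ 8100 * (L : ℝ) ^ 6 / θ := by positivity
  have h4 := mul_le_mul_of_nonneg_left h3 hL
  linarith

end Summit.QuantumFields.YangMills.Theorems.SwapVirialDeficit.BlowUpRing

end
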